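import Summits.Ventures.QEC.Census.CertChunks
import Summits.Ventures.QEC.Census.CertBZInfoSets
import HarnessLib

/-!
# Chunked kernel replays of the Brouwer–Zimmermann enumeration (method `bz` / `bz_aut`, check C4)
# (plan/CERT-FORMAT.md v1.1 §5.3 + §7 chunking; plan/CERT-REQS.md C17; emitter qec-search-10)

Type-10's `Census/CertCheckBZ.lean` states the C4 replay of one enumeration matrix as ONE `scan`
(`matrixEnumOK wmax allow Gb mt = scan (bzLeaf wmax allow) (rowPos (giRows Gb mt) 0) mt.t 0 0`,
`Census/CertBZInfoSets.lean`), consumed per (side, block, matrix) as `DistCert.bzZEnum` / `bzXEnum` by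
`bzZBlock_of_parts` and then by the soundness theorems (`CertCheckBZSound`, `CertCheckBZAutSound`). One kernel
evaluation (`decide +kernel`, default heartbeats) is bounded — measured 2026-08-26 on the farm (qec-search-10,
HOME/census/search-10/bz/probes): ≈ 1.2 ms per end point for `[[108,8,10]]` (108-bit words, `wtGt 9`), ≈ 2.0 ms for
`[[144,12,12]]`, and the heartbeat budget ends one evaluation near 2·10⁵ heartbeat-seconds — so a depth-4 matrix of
the `[[108,8,10]]` certificate (3.4·10⁵ end points) and every matrix of the `[[144,12,12]]` certificate must be
replayed in CHUNKS. This file is the glue, generic in the code: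

* `scan_of_reaches` — the converse of type-10's `scan_sublist`: a replay that reaches every sublist passes, so the
  chunk lemmas of `Census/CertChunks.lean` (qec-search-7: `chunk1`/`chunk2`/`chunk1R`/`chunk2R`,
  `reaches_origin_of_chunk1`, `reaches_chunk1_of_chunk2`, `forall_of_chunk1R`, …), which conclude `Reaches`, give
  back the Bool `scan … = true` that `matrixEnumOK` literally is;
* `matrixEnumOK_of_chunk1` and the `DistCert`-level wrappers `bzZEnum_of_chunk1` / `bzXEnum_of_chunk1`: level-1
  chunk facts over the row positions `rowPos G 0` of the matrix `G = giRows Gb mt` (taken as a literal `G` with a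
  `decide`d equation, or as the term itself with `rfl`) ⇒ `c.bzZEnum z b i = true` in type-10's exact vocabulary.

Nothing here is specific to a code; no `decide` is run in this file; axioms standard.
-/

namespace Summit.Ventures.QEC.Census

/-! ## A replay that reaches every sublist passes -/

/-- **Converse of `scan_sublist`**: if `test` holds at `(v ⊕ xorFst S, s ⊕ xorSnd S)` for every sublist `S` of `L`
of length `≤ b` (`Reaches test L b v s`), then `scan test L b v s = true`. With `scan_sublist` this makes the Bool
replay and the `Reaches` proposition interchangeable, so a scan may be ESTABLISHED chunk by chunk. -/
theorem scan_of_reaches (test : ℕ → ℕ → Bool) :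
    ∀ (L : List (ℕ × ℕ)) (b v s : ℕ), Reaches test L b v s → scan test L b v s = true := by
  intro L
  induction L with
  | nil =>
    intro b v s h
    have h0 := h [] (List.nil_sublist _) (Nat.zero_le _)
    simpa [scan, xorFst, xorSnd, xorList] using h0
  | cons a L ih =>
    intro b v s h
    cases b with
    | zero =>
      have h0 := h [] (List.nil_sublist _) (le_refl 0)
      simpa [scan, xorFst, xorSnd, xorList] using h0
    | succ b =>
      obtain ⟨p, c⟩ := a
      simp only [scan, Bool.and_eq_true]
      refine ⟨ih (b + 1) v s fun S hS hlen => h S (hS.cons _) hlen, ih b (v ^^^ p) (s ^^^ c) fun S hS hlen => ?_⟩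
      have h1 := h ((p, c) :: S) (hS.cons_cons _) (by simpa using hlen)
      rw [xorFst_cons, xorSnd_cons] at h1
      simpa [Nat.xor_assoc] using h1

/-- `scan … = true` and `Reaches …` are equivalent. -/
theorem scan_eq_true_iff_reaches (test : ℕ → ℕ → Bool) (L : List (ℕ × ℕ)) (b v s : ℕ) :
    scan test L b v s = true ↔ Reaches test L b v s :=
  ⟨reaches_of_scan, scan_of_reaches test L b v s⟩

/-! ## From level-1 chunk facts to `matrixEnumOK` -/

/-- The row-position list has one position per row. -/
theorem length_rowPos (G : List ℕ) (j : ℕ) : (rowPos G j).length = G.length := by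
  induction G generalizing j with
  | nil => rfl
  | cons g gs ih => simp [rowPos, ih]

/-- The BZ leaf holds at the empty selection (`u = 0`). -/
theorem bzLeaf_zero (wmax : ℕ) (allow : List ℕ) (c : ℕ) : bzLeaf wmax allow 0 c = true := by
  simp [bzLeaf]

/-- **Level-1 chunks ⇒ the matrix verdict.** For an enumeration matrix with rows `G = giRows Gb mt` (`hG`; a literal
or `rfl`) and depth `mt.t = t + 1`: if for every row index `i < |G|` the replay of budget `t` over the rows AFTER `i`,
started from row `i` (selection word `2^i`, codeword `G[i]`) reaches every sublist — which is what a passing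
`chunk1` / a packed `chunk1R` range (`forall_of_chunk1R`) / the level-2 chunks of `i` (`reaches_chunk1_of_chunk2`)
establish — then `matrixEnumOK wmax allow Gb mt = true`. The row count is taken as a numeral `n`. -/
theorem matrixEnumOK_of_chunk1 {wmax : ℕ} {allow Gb : List ℕ} {mt : BZMatrix} (G : List ℕ) (hG : giRows Gb mt = G)
    {t : ℕ} (ht : mt.t = t + 1) (n : ℕ) (hn : G.length = n)
    (h : ∀ i, i < n → Reaches (bzLeaf wmax allow) ((rowPos G 0).drop (i + 1)) t
      ((rowPos G 0).getD i (0, 0)).1 ((rowPos G 0).getD i (0, 0)).2) :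
    matrixEnumOK wmax allow Gb mt = true := by
  rw [matrixEnumOK, hG, ht]
  exact scan_of_reaches _ _ _ _ _
    (reaches_origin_of_chunk1 n (by rw [length_rowPos, hn]) (bzLeaf_zero _ _ _) h)

/-- The monolithic form, for completeness: a matrix verdict from ONE `Reaches` of the whole replay. -/
theorem matrixEnumOK_of_reaches {wmax : ℕ} {allow Gb : List ℕ} {mt : BZMatrix} (G : List ℕ) (hG : giRows Gb mt = G)
    (h : Reaches (bzLeaf wmax allow) (rowPos G 0) mt.t 0 0) : matrixEnumOK wmax allow Gb mt = true := by
  rw [matrixEnumOK, hG]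
  exact scan_of_reaches _ _ _ _ _ h

namespace DistCert

variable (c : DistCert) (z : BZData)

/-- **`Z` side, block `b`, matrix `i` from level-1 chunks** (the shape the emitted kernel files use): the block and
matrix literals located in the data (`hb`, `hi` by `rfl`), the matrix rows `G` (`hG` by `decide`/`rfl`), the
threshold `w = dZ − 1`, the allow-list words, the depth `t + 1` and the row count `n` as numerals, and the chunk
facts ⇒ `c.bzZEnum z b i = true`. -/
theorem bzZEnum_of_chunk1 {b i : ℕ} {blk : BZBlock} {mt : BZMatrix}
    (hb : z.sideZ.blocks[b]? = some blk) (hi : blk.mats[i]? = some mt)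
    (G : List ℕ) (hG : giRows (gbRows c.HZ z.rcZ z.LZ blk) mt = G)
    (w : ℕ) (hw : c.dZ - 1 = w) (allow : List ℕ) (hallow : c.sideZ.found.map Prod.fst = allow)
    {t : ℕ} (ht : mt.t = t + 1) (n : ℕ) (hn : G.length = n)
    (h : ∀ j, j < n → Reaches (bzLeaf w allow) ((rowPos G 0).drop (j + 1)) t
      ((rowPos G 0).getD j (0, 0)).1 ((rowPos G 0).getD j (0, 0)).2) :
    c.bzZEnum z b i = true := by
  simp only [bzZEnum, hb, hi]
  rw [hw, hallow]
  exact matrixEnumOK_of_chunk1 G hG ht n hn h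

/-- **`X` side, block `b`, matrix `i` from level-1 chunks** (roles exchanged: stabilizers `HX`, generators `LX`,
threshold `dX − 1`, allow-list of `sideX`). -/
theorem bzXEnum_of_chunk1 {b i : ℕ} {blk : BZBlock} {mt : BZMatrix}
    (hb : z.sideX.blocks[b]? = some blk) (hi : blk.mats[i]? = some mt)
    (G : List ℕ) (hG : giRows (gbRows c.HX z.rcX z.LX blk) mt = G)
    (w : ℕ) (hw : c.dX - 1 = w) (allow : List ℕ) (hallow : c.sideX.found.map Prod.fst = allow)
    {t : ℕ} (ht : mt.t = t + 1) (n : ℕ) (hn : G.length = n)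
    (h : ∀ j, j < n → Reaches (bzLeaf w allow) ((rowPos G 0).drop (j + 1)) t
      ((rowPos G 0).getD j (0, 0)).1 ((rowPos G 0).getD j (0, 0)).2) :
    c.bzXEnum z b i = true := by
  simp only [bzXEnum, hb, hi]
  rw [hw, hallow]
  exact matrixEnumOK_of_chunk1 G hG ht n hn h

/-- `Z` side, monolithic `Reaches` form (one replay established otherwise than by a single `decide`). -/
theorem bzZEnum_of_reaches {b i : ℕ} {blk : BZBlock} {mt : BZMatrix}
    (hb : z.sideZ.blocks[b]? = some blk) (hi : blk.mats[i]? = some mt)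
    (G : List ℕ) (hG : giRows (gbRows c.HZ z.rcZ z.LZ blk) mt = G)
    (w : ℕ) (hw : c.dZ - 1 = w) (allow : List ℕ) (hallow : c.sideZ.found.map Prod.fst = allow)
    (h : Reaches (bzLeaf w allow) (rowPos G 0) mt.t 0 0) : c.bzZEnum z b i = true := by
  simp only [bzZEnum, hb, hi]
  rw [hw, hallow]
  exact matrixEnumOK_of_reaches G hG h

end DistCert

/-! ## Control: the Steane certificate's first matrix, replayed as two level-1 chunks -/

/-- Control (Steane `[[7,1,3]]`, `Z` side, block 0, matrix 0, depth 1 = 0 + 1, 4 rows): the matrix verdict from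
four level-1 chunks of budget `0` packed as ONE `chunk1R` range — the same term shape the emitted files use. -/
theorem bzZEnum_certSteane7_chunked : certSteane7.bzZEnum bzSteane 0 0 = true :=
  DistCert.bzZEnum_of_chunk1 certSteane7 bzSteane (b := 0) (i := 0) rfl rfl
    (giRows (gbRows certSteane7.HZ bzSteane.rcZ bzSteane.LZ (bzSteane.sideZ.blocks[0]'(by decide)))
      ((bzSteane.sideZ.blocks[0]'(by decide)).mats[0]'(by decide))) (by decide)
    2 (by decide) (certSteane7.sideZ.found.map Prod.fst) rfl (t := 0) (by decide) 4 (by decide)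
    (forall_lt_append forall_lt_zero
      (forall_of_chunk1R (test := bzLeaf 2 (certSteane7.sideZ.found.map Prod.fst)) (b := 0) (i0 := 0) (len := 4)
        (by decide)))

end Summit.Ventures.QEC.Census
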